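import Summits.CriticalPhenomena.PercolationContinuityZ3.Theses.PercNecklaceBackbone
import Summits.CriticalPhenomena.PercolationContinuityZ3.Theorems.PercNecklaceBackboneNecklaceFatTails
import HarnessLib

/-!
# Route `PercNecklaceBackbone`: the `Assembly` (stmt-CriticalPhenomena-5274)

`Assembly = NoBackbone → TruncatedSusceptibilityFiniteOfTheta → PercolationContinuityZ3`.

This is the route's deciding theorem
`Summit.CriticalPhenomena.PercolationContinuityZ3.Theses.PercNecklaceBackbone.closes :
NoBackbone → TruncatedSusceptibilityFiniteOfTheta → NecklaceFatTails → PercolationContinuityZ3`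
with its third hypothesis discharged by the landed one-edge surgery
`PercNecklaceBackboneNecklaceFatTails.necklaceFatTails_proof : NecklaceFatTails`
(item stmt-CriticalPhenomena-5273): if `θ(p_c) > 0` then, under `NoBackbone`, the truncated
connectivity `x ↦ P_{p_c}(0 ↔ x, |C(0)| < ∞)` is not summable (`NecklaceFatTails`), while
`L = TruncatedSusceptibilityFiniteOfTheta` at `p = p_c` says it is — so `θ(p_c) = 0`, which is
`PercolationContinuityZ3` (`percolationContinuityZ3_iff`, inside `closes`).

References: Aizenman–Kesten–Newman, Comm. Math. Phys. 111 (1987); Grimmett, *Percolation* (1999),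
§8.2 — for the surgery (sibling file); the present file is pure logic.
-/

namespace Summit.CriticalPhenomena.PercolationContinuityZ3.Theorems

/-- **`Assembly`** of route `PercNecklaceBackbone` (item stmt-CriticalPhenomena-5274, exact
signature): `NoBackbone → TruncatedSusceptibilityFiniteOfTheta → PercolationContinuityZ3`, obtained
from the route's deciding theorem `closes` by discharging `NecklaceFatTails` with
`PercNecklaceBackboneNecklaceFatTails.necklaceFatTails_proof`. [folklore] -/
theorem percNecklaceBackbone_assembly_proof :
    Summit.CriticalPhenomena.PercolationContinuityZ3.Theses.PercNecklaceBackbone.Assembly := by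
  unfold Theses.PercNecklaceBackbone.Assembly
  intro hNB hL
  exact Theses.PercNecklaceBackbone.closes hNB hL
    PercNecklaceBackboneNecklaceFatTails.necklaceFatTails_proof

end Summit.CriticalPhenomena.PercolationContinuityZ3.Theorems
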